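import Summits.BirchSwinnertonDyer.BirchSwinnertonDyer.Theorems.ManinLocalTwoThreeQFareyCusps
import Summits.BirchSwinnertonDyer.BirchSwinnertonDyer.Theorems.ManinLocalTwoThreeFareyConnected
import Summits.BirchSwinnertonDyer.Rank1Residual.ManinAdditive.TowerExtensionHolds

/-!
# E-an-140 `QFareyFibreConnected` PROVED: the q-Farey graph on the denominator fibre `±⟨q⟩ ⊂ (ℤ/N)ˣ` is connected
# (cell bsd-f2-manin, analytic lens g30, MEMO-an §72.3; the `SL₂(ℤ[1/q])` layer of the orbit-graph instantiation E-an-141 ⟹ E-an-140)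

Summit `BirchSwinnertonDyer`, route `ManinLocalTwoThree`, cruxes C3 `ManinPrimeToThreeAtNine` (stmt-BirchSwinnertonDyer-22968) / C2 `ManinOddAtFour`
(stmt-…-22967).  an's orbit-graph lemma (§72.3): `Γ_S^{±q}(N)` acts on the fibre, transitively (integral Bezout element), preserving the
q-Farey edges; the generators `B⁺(ℤ[1/q]) ∪ U⁻(Nℤ[1/q])` of E-an-141 map `0` to a q-adic cusp `m/qʲ` (joined to `0`, LEMMA Q) resp. fix `0`;
hence every element of `⟨B⁺ ∪ U⁻(N·)⟩ ⊇ Γ_S^{±q}(N)` (E-an-141 = `TowerExtension.sArithBorelGeneration_holds`, typer g15, from the tree's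
Vaserstein theorem) transports connectivity to `0` (`moebiusGood_of_mem_closure`, a `Subgroup.closure` induction over an arbitrary ring map
`φ : ℤ[1/q] →+* ℚ` using `…QFareyTransport` / `…QFareyCusps`), and the Bezout element carries `0` to the given vertex `B/D`.

* `moebiusGood_of_mem_borelLowerSet`, `inv_mem_borelLowerSet`, `moebiusGood_of_mem_closure` — the induction;
* `exists_mem_sCongruenceSet_apply_eq` — the transitivity element `(u B; v D) ∈ Γ_S^{±q}(N)`, `N ∣ v`;
* `borelGenerationImpliesConnected : TowerExtension.BorelGenerationImpliesConnected` — an's edge E-an-141 ⟹ E-an-140, BY NAME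
  (`N = 1`: the Farey graph itself, `qFareyFibreConnected_one`);
* `qFareyFibreConnected_holds (N q) : TowerExtension.QFareyFibreConnected N q` — **E-an-140 is a theorem of the tree** (via typer's
  `qFareyFibreConnected_of_borelGenerationImpliesConnected`).

HONEST FRAMING: this settles the COMBINATORIAL rung (connectivity / (GEN𝒵) input) of an's §72 extension ladder; THEOREM Z's Hecke bookkeeping
(L2), the exceptional-cell analysis E-an-142 and the law E-an-137 `UnipotentTowerGeneration` remain open.  Nothing about Manin's conjecture
or BSD is proved here.
-/

set_option linter.dupNamespace false
set_option autoImplicit false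

namespace Summit.BirchSwinnertonDyer.BirchSwinnertonDyer.Theorems.ManinLocalTwoThree

open Summit.BirchSwinnertonDyer.Rank1Residual.ManinAdditive.TowerExtension
open Matrix
open scoped MatrixGroups

section SL2Layer

variable {N q : ℕ}

/-- Every element of `ℤ[1/q]` becomes an integer after multiplication by a power of `q` (under any ring map to `ℚ`). -/
theorem exists_int_mul_pow_of_away (φ : Rq q →+* ℚ) (r : Rq q) : ∃ (z : ℤ) (j : ℕ), φ r * (q : ℚ) ^ j = z := by
  obtain ⟨⟨z, s⟩, h⟩ := IsLocalization.surj (Submonoid.powers (q : ℤ)) r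
  obtain ⟨j, hj⟩ := (Submonoid.mem_powers_iff _ _).mp s.2
  refine ⟨z, j, ?_⟩
  have h' := congrArg φ h
  rw [map_mul] at h'
  simp only at h'
  rw [← hj] at h'
  simpa using h'

/-- In `ℚ`: if `u d = qᴷ` for integers then `d = ±qⁱ`, hence `d ≡ ±qⁱ (mod N)`. -/
theorem zmod_eq_pm_pow_of_mul_eq_pow (hq : q.Prime) {u d : ℤ} {K : ℕ} (h : u * d = (q : ℤ) ^ K) :
    ∃ i : ℕ, (d = (q : ℤ) ^ i ∨ d = -((q : ℤ) ^ i)) ∧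
      ((d : ZMod N) = (q : ZMod N) ^ i ∨ (d : ZMod N) = -((q : ZMod N) ^ i)) := by
  obtain ⟨i, -, hi⟩ := natAbs_eq_pow_of_dvd_prime_pow hq (Dvd.intro_left u h)
  refine ⟨i, ?_⟩
  rcases Int.natAbs_eq d with hd | hd <;> rw [hd, hi]
  · exact ⟨Or.inl (by push_cast; rfl), Or.inl (by push_cast; rfl)⟩
  · exact ⟨Or.inr (by push_cast; rfl), Or.inr (by push_cast; rfl)⟩

/-- The generators transport connectivity: `𝒫(φ γ)` for `γ ∈ B⁺(ℤ[1/q]) ∪ U⁻(Nℤ[1/q])` (`N ≥ 2`).  Borel: integral form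
`(a₀, b₀, 0, d₀)` with `a₀ d₀ = q²ᴶ`, so `d₀ = ±qⁱ` and `γ·0 = ±b₀/qⁱ` is a q-adic cusp (LEMMA Q); lower unipotent: `(qʲ, 0, N z, qʲ)`, `γ·0 = 0`. -/
theorem moebiusGood_of_mem_borelLowerSet (hN : 2 ≤ N) (hq : q.Prime) (hqN : q.Coprime N) (φ : Rq q →+* ℚ)
    {γ : SL(2, Rq q)} (hγ : γ ∈ borelLowerSet N q) :
    ∀ x : ℚ, InFibre N q x.den →
      φ (γ 1 0) * x + φ (γ 1 1) ≠ 0 ∧ InFibre N q ((φ (γ 0 0) * x + φ (γ 0 1)) / (φ (γ 1 0) * x + φ (γ 1 1))).den ∧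
        (Relation.ReflTransGen (fun x y : ℚ ↦ QFareyAdj N q (x.num, x.den) (y.num, y.den)) 0 x →
          Relation.ReflTransGen (fun x y : ℚ ↦ QFareyAdj N q (x.num, x.den) (y.num, y.den)) 0
            ((φ (γ 0 0) * x + φ (γ 0 1)) / (φ (γ 1 0) * x + φ (γ 1 1)))) := by
  have hq0 : (q : ℚ) ≠ 0 := by exact_mod_cast hq.ne_zero
  have hdet : γ 0 0 * γ 1 1 - γ 0 1 * γ 1 0 = 1 := by
    have h := γ.det_coe
    rw [Matrix.det_fin_two] at h
    exact h
  rcases hγ with hc | ⟨h00, h11, h01, h10⟩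
  · -- Borel: `γ 1 0 = 0`
    have hc' : γ 1 0 = 0 := hc
    obtain ⟨za, ja, ha⟩ := exists_int_mul_pow_of_away φ (γ 0 0)
    obtain ⟨zb, jb, hb⟩ := exists_int_mul_pow_of_away φ (γ 0 1)
    obtain ⟨zd, jd, hd⟩ := exists_int_mul_pow_of_away φ (γ 1 1)
    have hφdet : φ (γ 0 0) * φ (γ 1 1) = 1 := by
      have h := congrArg φ hdet
      rw [hc', mul_zero, sub_zero, map_mul, map_one] at h
      exact h
    -- integral form with `J = ja + jb + jd`
    have hA : φ (γ 0 0) * (q : ℚ) ^ (ja + jb + jd) = ((za * (q : ℤ) ^ (jb + jd) : ℤ) : ℚ) := by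
      push_cast; rw [← ha]; ring
    have hB : φ (γ 0 1) * (q : ℚ) ^ (ja + jb + jd) = ((zb * (q : ℤ) ^ (ja + jd) : ℤ) : ℚ) := by
      push_cast; rw [← hb]; ring
    have hC : φ (γ 1 0) * (q : ℚ) ^ (ja + jb + jd) = ((0 : ℤ) : ℚ) := by rw [hc', map_zero]; simp
    have hD : φ (γ 1 1) * (q : ℚ) ^ (ja + jb + jd) = ((zd * (q : ℤ) ^ (ja + jb) : ℤ) : ℚ) := by
      push_cast; rw [← hd]; ring
    have hdet₀ : (za * (q : ℤ) ^ (jb + jd)) * (zd * (q : ℤ) ^ (ja + jb)) - (zb * (q : ℤ) ^ (ja + jd)) * 0 =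
        (q : ℤ) ^ (2 * (ja + jb + jd)) := by
      have h : (((za * (q : ℤ) ^ (jb + jd)) * (zd * (q : ℤ) ^ (ja + jb)) : ℤ) : ℚ) = (((q : ℤ) ^ (2 * (ja + jb + jd)) : ℤ) : ℚ) := by
        push_cast
        rw [← ha, ← hd]
        calc φ (γ 0 0) * (q : ℚ) ^ ja * (q : ℚ) ^ (jb + jd) * (φ (γ 1 1) * (q : ℚ) ^ jd * (q : ℚ) ^ (ja + jb))
            = (φ (γ 0 0) * φ (γ 1 1)) * ((q : ℚ) ^ ja * (q : ℚ) ^ (jb + jd) * ((q : ℚ) ^ jd * (q : ℚ) ^ (ja + jb))) := by ring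
          _ = (q : ℚ) ^ (2 * (ja + jb + jd)) := by rw [hφdet, one_mul]; ring
      rw [mul_zero, sub_zero]
      exact_mod_cast h
    obtain ⟨i, hdi, hdmod⟩ := zmod_eq_pm_pow_of_mul_eq_pow (N := N) hq
      (u := za * (q : ℤ) ^ (jb + jd)) (d := zd * (q : ℤ) ^ (ja + jb)) (K := 2 * (ja + jb + jd))
      (by have := hdet₀; rw [mul_zero, sub_zero] at this; exact this)
    refine moebiusGood_of_integral hN hq hqN hA hB hC hD hdet₀ (dvd_zero _) ⟨i, hdmod⟩ ?_
    -- `γ·0 = b/d = ± b₀ / qⁱ`, a q-adic cusp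
    have hqJ : (q : ℚ) ^ (ja + jb + jd) ≠ 0 := pow_ne_zero _ hq0
    obtain ⟨σ, hσ, hdσ⟩ : ∃ σ : ℤ, (σ = 1 ∨ σ = -1) ∧ zd * (q : ℤ) ^ (ja + jb) = σ * (q : ℤ) ^ i := by
      rcases hdi with h | h
      · exact ⟨1, Or.inl rfl, by rw [h, one_mul]⟩
      · exact ⟨-1, Or.inr rfl, by rw [h]; ring⟩
    have hval : φ (γ 0 1) / φ (γ 1 1) = (((σ * (zb * (q : ℤ) ^ (ja + jd)) : ℤ)) : ℚ) / (q : ℚ) ^ i := by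
      have hd' : φ (γ 1 1) = (σ : ℚ) * (q : ℚ) ^ i / (q : ℚ) ^ (ja + jb + jd) := by
        rw [eq_div_iff hqJ, hD]; exact_mod_cast hdσ
      have hb' : φ (γ 0 1) = ((zb * (q : ℤ) ^ (ja + jd) : ℤ) : ℚ) / (q : ℚ) ^ (ja + jb + jd) := by
        rw [eq_div_iff hqJ, hB]
      have hσ0 : (σ : ℚ) ≠ 0 := by rcases hσ with rfl | rfl <;> norm_num
      rw [hd', hb']
      have hqi : (q : ℚ) ^ i ≠ 0 := pow_ne_zero _ hq0
      have hden1 : (σ : ℚ) * (q : ℚ) ^ i / (q : ℚ) ^ (ja + jb + jd) ≠ 0 := div_ne_zero (mul_ne_zero hσ0 hqi) hqJ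
      rw [div_eq_div_iff hden1 hqi]
      rcases hσ with rfl | rfl <;> push_cast <;> ring
    rw [hval]
    exact qFarey_reflTransGen_zero_qadic hq hqN i _
  · -- lower unipotent: `γ = (1 0; c 1)`, `c ∈ (N)`
    obtain ⟨r, hr⟩ := Ideal.mem_span_singleton'.mp h10
    obtain ⟨z, j, hz⟩ := exists_int_mul_pow_of_away φ r
    have hA : φ (γ 0 0) * (q : ℚ) ^ j = (((q : ℤ) ^ j : ℤ) : ℚ) := by rw [h00, map_one]; simp
    have hB : φ (γ 0 1) * (q : ℚ) ^ j = ((0 : ℤ) : ℚ) := by rw [h01, map_zero]; simp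
    have hC : φ (γ 1 0) * (q : ℚ) ^ j = (((N : ℤ) * z : ℤ) : ℚ) := by
      rw [← hr, map_mul, map_natCast]; push_cast; rw [← hz]; ring
    have hD : φ (γ 1 1) * (q : ℚ) ^ j = (((q : ℤ) ^ j : ℤ) : ℚ) := by rw [h11, map_one]; simp
    have hdet₀ : (q : ℤ) ^ j * (q : ℤ) ^ j - 0 * ((N : ℤ) * z) = (q : ℤ) ^ (2 * j) := by ring
    refine moebiusGood_of_integral hN hq hqN hA hB hC hD hdet₀ (dvd_mul_right _ _)
      ⟨j, Or.inl (by push_cast; rfl)⟩ ?_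
    rw [h01, h11, map_zero, map_one, zero_div]

/-- `B⁺(ℤ[1/q]) ∪ U⁻(Nℤ[1/q])` is closed under inverses. -/
theorem inv_mem_borelLowerSet {γ : SL(2, Rq q)} (hγ : γ ∈ borelLowerSet N q) : γ⁻¹ ∈ borelLowerSet N q := by
  rw [Matrix.SpecialLinearGroup.SL2_inv_expl]
  rcases hγ with hc | ⟨h00, h11, h01, h10⟩
  · left
    have hc' : γ 1 0 = 0 := hc
    show (![![γ.1 1 1, -γ.1 0 1], ![-γ.1 1 0, γ.1 0 0]] : Matrix (Fin 2) (Fin 2) (Rq q)) 1 0 = 0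
    simp [hc']
  · right
    refine ⟨?_, ?_, ?_, ?_⟩
    · show (![![γ.1 1 1, -γ.1 0 1], ![-γ.1 1 0, γ.1 0 0]] : Matrix (Fin 2) (Fin 2) (Rq q)) 0 0 = 1
      simp [h11]
    · show (![![γ.1 1 1, -γ.1 0 1], ![-γ.1 1 0, γ.1 0 0]] : Matrix (Fin 2) (Fin 2) (Rq q)) 1 1 = 1
      simp [h00]
    · show (![![γ.1 1 1, -γ.1 0 1], ![-γ.1 1 0, γ.1 0 0]] : Matrix (Fin 2) (Fin 2) (Rq q)) 0 1 = 0
      simp [h01]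
    · show (![![γ.1 1 1, -γ.1 0 1], ![-γ.1 1 0, γ.1 0 0]] : Matrix (Fin 2) (Fin 2) (Rq q)) 1 0 ∈ _
      simpa using neg_mem h10

/-- **The orbit-graph induction**: every `γ ∈ ⟨B⁺(ℤ[1/q]) ∪ U⁻(Nℤ[1/q])⟩` is defined on the fibre, preserves it, and transports
connectivity to `0` (`N ≥ 2`; `Subgroup.closure_induction''` with `moebiusGood_one` / `moebiusGood_mul`). -/
theorem moebiusGood_of_mem_closure (hN : 2 ≤ N) (hq : q.Prime) (hqN : q.Coprime N) (φ : Rq q →+* ℚ)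
    {γ : SL(2, Rq q)} (hγ : γ ∈ Subgroup.closure (borelLowerSet N q)) :
    ∀ x : ℚ, InFibre N q x.den →
      φ (γ 1 0) * x + φ (γ 1 1) ≠ 0 ∧ InFibre N q ((φ (γ 0 0) * x + φ (γ 0 1)) / (φ (γ 1 0) * x + φ (γ 1 1))).den ∧
        (Relation.ReflTransGen (fun x y : ℚ ↦ QFareyAdj N q (x.num, x.den) (y.num, y.den)) 0 x →
          Relation.ReflTransGen (fun x y : ℚ ↦ QFareyAdj N q (x.num, x.den) (y.num, y.den)) 0
            ((φ (γ 0 0) * x + φ (γ 0 1)) / (φ (γ 1 0) * x + φ (γ 1 1)))) := by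
  induction hγ using Subgroup.closure_induction'' with
  | mem γ hγ => exact moebiusGood_of_mem_borelLowerSet hN hq hqN φ hγ
  | inv_mem γ hγ => exact moebiusGood_of_mem_borelLowerSet hN hq hqN φ (inv_mem_borelLowerSet hγ)
  | one =>
    intro x hx
    have h := moebiusGood_one (N := N) (q := q) x hx
    simpa [Matrix.one_apply_eq, Matrix.one_apply_ne] using h
  | mul γ₁ γ₂ _ _ ih₁ ih₂ =>
    intro x hx
    have h := moebiusGood_mul ih₁ ih₂ x hx
    simp only [Matrix.SpecialLinearGroup.coe_mul, Matrix.mul_apply, Fin.sum_univ_two, map_add, map_mul]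
    exact h

/-- **Transitivity element**: for a fibre vertex `B/D` there is `γ = (u B; v D) ∈ Γ_S^{±q}(N)` (`u D − B v = 1`, `N ∣ v`), and
`γ·0 = B/D` under any `φ : ℤ[1/q] →+* ℚ`. -/
theorem exists_mem_sCongruenceSet_apply_eq (φ : Rq q →+* ℚ) (B : ℤ) (D : ℕ) (hBD : Int.gcd B D = 1)
    (hfib : InFibre N q D) :
    ∃ γ : SL(2, Rq q), γ ∈ sCongruenceSet N q ∧
      (φ (γ 0 0) * 0 + φ (γ 0 1)) / (φ (γ 1 0) * 0 + φ (γ 1 1)) = (B : ℚ) / (D : ℚ) := by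
  obtain ⟨hDN, e, he⟩ := hfib
  -- `gcd(D, N B) = 1`
  have h1 : IsCoprime (D : ℤ) ((N : ℤ) * B) := by
    refine IsCoprime.mul_right ?_ ?_
    · exact Int.isCoprime_iff_gcd_eq_one.mpr (by
        rw [Int.gcd_natCast_natCast]; exact hDN)
    · exact (Int.isCoprime_iff_gcd_eq_one.mpr hBD).symm
  obtain ⟨u, w, huw⟩ := h1
  -- `γ = (u B; -wN D)`, `det = u D + w N B = 1`
  have hdet : (u : Rq q) * (D : Rq q) - (B : Rq q) * ((-(w * N) : ℤ) : Rq q) = 1 := by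
    have h := congrArg (Int.cast : ℤ → Rq q) huw
    push_cast at h ⊢
    linear_combination h
  refine ⟨⟨!![(u : Rq q), (B : Rq q); ((-(w * N) : ℤ) : Rq q), (D : Rq q)], by rw [Matrix.det_fin_two_of]; exact hdet⟩,
    ⟨?_, ?_⟩, ?_⟩
  · show ((-(w * N) : ℤ) : Rq q) ∈ Ideal.span {(N : Rq q)}
    exact Ideal.mem_span_singleton'.mpr ⟨((-w : ℤ) : Rq q), by push_cast; ring⟩
  · refine ⟨e, ?_⟩
    show (D : Rq q) - (q : Rq q) ^ e ∈ Ideal.span {(N : Rq q)} ∨ (D : Rq q) + (q : Rq q) ^ e ∈ Ideal.span {(N : Rq q)}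
    rcases he with he | he
    · left
      have he' : ((D : ℤ) : ZMod N) = (((q : ℤ) ^ e : ℤ) : ZMod N) := by push_cast; exact he
      obtain ⟨t, ht⟩ := (ZMod.intCast_eq_intCast_iff_dvd_sub _ _ _).mp he'
      refine Ideal.mem_span_singleton'.mpr ⟨((-t : ℤ) : Rq q), ?_⟩
      have h := congrArg (Int.cast : ℤ → Rq q) ht
      push_cast at h ⊢
      linear_combination h
    · right
      have he' : ((D : ℤ) : ZMod N) = ((-((q : ℤ) ^ e) : ℤ) : ZMod N) := by push_cast; exact he
      obtain ⟨t, ht⟩ := (ZMod.intCast_eq_intCast_iff_dvd_sub _ _ _).mp he'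
      refine Ideal.mem_span_singleton'.mpr ⟨((-t : ℤ) : Rq q), ?_⟩
      have h := congrArg (Int.cast : ℤ → Rq q) ht
      push_cast at h ⊢
      linear_combination h
  · show (φ (u : Rq q) * 0 + φ (B : Rq q)) / (φ (((-(w * N) : ℤ) : Rq q)) * 0 + φ (D : Rq q)) = (B : ℚ) / (D : ℚ)
    simp

end SL2Layer

/-- **an's orbit-graph edge E-an-141 ⟹ E-an-140, BY NAME** (§72.3): Borel-plus-lower-unipotent generation of the S-congruence group
`Γ_S^{±q}(N) ⊂ SL₂(ℤ[1/q])` implies that the q-Farey graph on the denominator fibre `±⟨q⟩` is connected.  (`N = 1`: the Farey graph.) -/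
theorem borelGenerationImpliesConnected : BorelGenerationImpliesConnected := by
  intro N q hgen hq hqN hN B D hD hBD hfib
  rcases Nat.lt_or_ge N 2 with hN1 | hN2
  · obtain rfl : N = 1 := by omega
    exact qFareyFibreConnected_one q hq hqN hN B D hD hBD hfib
  · have hq0 : (q : ℚ) ≠ 0 := by exact_mod_cast hq.ne_zero
    let φ : Rq q →+* ℚ := Localization.awayLift (Int.castRingHom ℚ) (q : ℤ) (isUnit_iff_ne_zero.mpr (by simpa using hq0))
    obtain ⟨γ, hγS, hγ0⟩ := exists_mem_sCongruenceSet_apply_eq φ B D hBD hfib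
    have hcl : γ ∈ Subgroup.closure (borelLowerSet N q) := hgen hq hqN hN hγS
    have hP := moebiusGood_of_mem_closure hN2 hq hqN φ hcl 0 (by
      have h := inFibre_pow (N := N) hqN 0
      rwa [pow_zero] at h)
    have hconn := hP.2.2 Relation.ReflTransGen.refl
    rw [hγ0] at hconn
    -- back to vertices `(num, den)`
    have hlift := Relation.ReflTransGen.lift (r := fun x y : ℚ ↦ QFareyAdj N q (x.num, x.den) (y.num, y.den))
      (p := QFareyAdj N q) (fun x : ℚ ↦ (x.num, x.den)) (fun _ _ h ↦ h) _ _ hconn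
    have hcop : Nat.Coprime B.natAbs (D : ℤ).natAbs := by
      have h := hBD; unfold Int.gcd at h; exact h
    have hDpos : (0 : ℤ) < D := by exact_mod_cast hD
    have hnum : ((B : ℚ) / (D : ℚ)).num = B := by exact_mod_cast Rat.num_div_eq_of_coprime hDpos hcop
    have hden : ((B : ℚ) / (D : ℚ)).den = D := by exact_mod_cast Rat.den_div_eq_of_coprime hDpos hcop
    simpa [Function.onFun, hnum, hden] using hlift

/-- **E-an-140 `QFareyFibreConnected N q` PROVED for every `N, q`** (with E-an-141 `sArithBorelGeneration_holds` a tree theorem):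
for a prime `q ∤ N`, every reduced `B/D` with `D mod N ∈ ±⟨q⟩` is joined to `0/1` by q-Farey edges inside the fibre. -/
theorem qFareyFibreConnected_holds (N q : ℕ) : QFareyFibreConnected N q :=
  qFareyFibreConnected_of_borelGenerationImpliesConnected borelGenerationImpliesConnected N q

end Summit.BirchSwinnertonDyer.BirchSwinnertonDyer.Theorems.ManinLocalTwoThree
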